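import Summits.QuantumFields.GaugeBoot.Eqs.BindKitZ
import HarnessLib

/-!
# Binding bridge: the per-row data check of a torus binding in CODE space (cell `gauge-boot`, seat lean2, binding kit)

Cell `pub-gaugeboot` (HOME `run/shared/lean/pub/pub-gaugeboot/`).  HONEST FRAMING (page 1 of every file of this cell): certified
bounds on lattice expectations at STATED coupling, gauge group, dimension and torus size; NOT a mass gap, NOT a continuum limit,
NOT a string tension, NOT large `N`; NOT Yang–Mills-summit-bearing (barriers `FixedCouplingUltralocality`, `PerturbativeInvisibility`).

A torus binding (`Rows/<Fam>BindB<tag>`, lean1) must check, row by row, that the certificate's sparse equality row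
`(rhs, [(v, c), …])` (lean3's `RW`, columns `v` of the problem file) is — read through the label table `v ↦ word` — a
permutation of lean2's word-keyed row (`Eqs/<Fam>…`, `E_holds`/`row`), so that `E_holds` discharges the certificate's `heq`.
For the ℕ- and ℤ-keyed kits (`BindKitN.decW`, `BindKitZ.decWZ`: labels as DIGIT CODES, decoded by `wdg d`) deciding that
permutation on `(Word d × ℚ)` pairs in the kernel costs ≈ 1.4 s per row (measured on glyz-c2-rp-3D β 3: 20 rows 29 s; a
40-row `decide` chunk does not go through at all), i.e. ≈ 9 min per 346-row β and ≈ 24 min per 957-row 4D β.  This module moves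
the check to CODE SPACE with a POSITION WITNESS: `codeRowOKN` / `codeRowOKZ` compare, entry by entry along the certificate row,
the label's digit code `labelCode v` with the code of the matched lean2 term and the two coefficients (integer / one `ℚ`
multiplication each) — no word is decoded and no permutation is searched (≈ 20× cheaper; linear in the row).  The theorems
`rowOKg_of_codeRowOKN` / `rowOKg_of_codeRowOKZ` then DERIVE the word-level check `rowOKg` (the generic form of lean1's per-family
`rowOK`, definitionally: `<Fam>.rowOK rw er = rowOKg <Fam>.labelN nv rw er` by `rfl`) from (i) the code check and (ii) ONE
family fact `∀ v < nv, labelW v = wdg d (labelCode v)` (decidable once per family over its label table).  `forall_lt_of_chunks`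
assembles chunked kernel checks `(List.range' lo n).all F = true` into `∀ e < N, F e = true`.  Pure list bookkeeping; `[folklore]`.
-/

namespace Summit.QuantumFields.GaugeBoot.BindBridge

open Summit.QuantumFields.GaugeBoot.BindN Summit.QuantumFields.GaugeBoot.BindZ

variable {d : ℕ} [NeZero d]

/-! ## The word-level check (generic form of lean1's `rowOK`) -/

/-- The word-level per-row data check, generic in the label table `labelW` and the column bound `nv`: right-hand side `0`,
distinct columns `< nv`, vanishing `c1` components of the word row, and the labelled sparse row is a permutation of the word
row as lists of `(word, coefficient)` pairs.  `GLYZc2D3.rowOK rw er = rowOKg GLYZc2D3.labelN 1449 rw er` holds by `rfl`. [folklore] -/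
def rowOKg (labelW : ℕ → Word d) (nv : ℕ) (rw : ℚ × List (ℕ × ℚ)) (er : GRow (Word d)) : Bool :=
  decide (rw.1 = 0) && decide ((rw.2.map Prod.fst).Nodup) && rw.2.all (fun p => decide (p.1 < nv)) &&
    er.all (fun t => decide (t.2.2 = 0)) &&
    decide ((rw.2.map fun p => (labelW p.1, p.2)).Perm (er.map fun t => (t.1, t.2.1)))

/-! ## The code-level checks -/

/-- Common part of the code-space check: `rhs = 0`, distinct columns `< nv`, and the position witness `π` is a list of
`ts`-positions of the right length without repetitions. [folklore] -/
def shapeOK (nv : ℕ) (rw : ℚ × List (ℕ × ℚ)) (n : ℕ) (π : List ℕ) : Bool :=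
  decide (rw.1 = 0) && decide ((rw.2.map Prod.fst).Nodup) && rw.2.all (fun p => decide (p.1 < nv)) &&
    decide (rw.2.length = n) && decide (π.length = n) && decide π.Nodup && π.all (fun j => decide (j < n))

/-- **Code-space row check, ℕ-kit rows** (`BindKitN`: terms `(code, num, den)`, coefficient `num / den`): along the certificate
row `[(v_i, c_i)]` and the witness `π`, `labelCode v_i = code_{π i}`, `den_{π i} ≠ 0` and `c_i · den_{π i} = num_{π i}`. [folklore] -/
def codeRowOKN (labelCode : ℕ → ℕ) (nv : ℕ) (rw : ℚ × List (ℕ × ℚ)) (ts : List (ℕ × ℤ × ℕ)) (π : List ℕ) : Bool :=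
  shapeOK nv rw ts.length π &&
    (rw.2.zip π).all fun q =>
      decide (labelCode q.1.1 = (ts.getD q.2 (0, 0, 1)).1) && decide ((ts.getD q.2 (0, 0, 1)).2.2 ≠ 0) &&
        decide (q.1.2 * ((ts.getD q.2 (0, 0, 1)).2.2 : ℚ) = (ts.getD q.2 (0, 0, 1)).2.1)

/-- **Code-space row check, ℤ-kit rows** (`BindKitZ`: terms `(code, z)` with a row denominator `M`, coefficient `z / M`):
`M ≠ 0` and along the certificate row, `labelCode v_i = code_{π i}` and `c_i · M = z_{π i}`. [folklore] -/
def codeRowOKZ (labelCode : ℕ → ℕ) (nv : ℕ) (rw : ℚ × List (ℕ × ℚ)) (ts : List (ℕ × ℤ)) (M : ℕ) (π : List ℕ) : Bool :=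
  shapeOK nv rw ts.length π && decide (M ≠ 0) &&
    (rw.2.zip π).all fun q =>
      decide (labelCode q.1.1 = (ts.getD q.2 (0, 0)).1) && decide (q.1.2 * (M : ℚ) = (ts.getD q.2 (0, 0)).2)

/-! ## From the code check to the word check -/

/-- A list of naturals of length `n`, without repetitions, all `< n`, is a permutation of `range n`. [folklore] -/
theorem perm_range_of_nodup {π : List ℕ} {n : ℕ} (hnd : π.Nodup) (hlt : ∀ j ∈ π, j < n) (hlen : π.length = n) :
    π.Perm (List.range n) := by
  have hsub : π.Subperm (List.range n) :=
    hnd.subperm fun j hj => List.mem_range.2 (hlt j hj)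
  exact hsub.perm_of_length_le (by simp [hlen])

/-- `(range n).map (fun j => l.getD j a) = l` when `n = l.length`. [folklore] -/
theorem map_getD_range {α : Type*} (l : List α) (a : α) {n : ℕ} (hn : n = l.length) :
    (List.range n).map (fun j => l.getD j a) = l := by
  subst hn
  refine List.ext_getElem (by simp) fun i h₁ h₂ => ?_
  simp only [List.getElem_map, List.getElem_range]
  rw [List.getD_eq_getElem?_getD, List.getElem?_eq_getElem h₂, Option.getD_some]

/-- The core step: if along `zip rw π` every certificate entry `(v, c)` is matched with the `ts`-entry at position `π i`
under `f` / `g`, and `π` enumerates the positions of `ts` bijectively, then `rw.map f` is a permutation of `ts.map g`. [folklore] -/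
theorem perm_map_of_zip_witness {α β γ : Type*} (rw : List α) (ts : List β) (π : List ℕ) (f : α → γ) (g : β → γ) (b : β)
    (hlen : rw.length = ts.length) (hπ : π.length = ts.length) (hnd : π.Nodup) (hlt : ∀ j ∈ π, j < ts.length)
    (hmatch : ∀ q ∈ rw.zip π, f q.1 = g (ts.getD q.2 b)) :
    (rw.map f).Perm (ts.map g) := by
  have e1 : (rw.zip π).map Prod.fst = rw := List.map_fst_zip (by omega)
  have e2 : (rw.zip π).map Prod.snd = π := List.map_snd_zip (by omega)
  have h1 : rw.map f = (rw.zip π).map (fun q => f q.1) := by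
    conv_lhs => rw [← e1]
    rw [List.map_map]
    rfl
  have h2 : π.map (fun j => g (ts.getD j b)) = (rw.zip π).map (fun q => g (ts.getD q.2 b)) := by
    conv_lhs => rw [← e2]
    rw [List.map_map]
    rfl
  have h3 : (rw.zip π).map (fun q => f q.1) = (rw.zip π).map (fun q => g (ts.getD q.2 b)) :=
    List.map_congr_left hmatch
  rw [h1, h3, ← h2]
  have hperm : π.Perm (List.range ts.length) := perm_range_of_nodup hnd hlt hπ
  have h4 : (List.range ts.length).map (fun j => g (ts.getD j b)) = ts.map g := by
    rw [show (fun j => g (ts.getD j b)) = g ∘ (fun j => ts.getD j b) from rfl, ← List.map_map,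
      map_getD_range ts b rfl]
  rw [← h4]
  exact hperm.map _

/-- Unpacking `shapeOK`. [folklore] -/
theorem shapeOK_iff (nv : ℕ) (rw : ℚ × List (ℕ × ℚ)) (n : ℕ) (π : List ℕ) :
    shapeOK nv rw n π = true ↔
      rw.1 = 0 ∧ (rw.2.map Prod.fst).Nodup ∧ (∀ p ∈ rw.2, p.1 < nv) ∧ rw.2.length = n ∧ π.length = n ∧ π.Nodup ∧
        ∀ j ∈ π, j < n := by
  simp only [shapeOK, Bool.and_eq_true, decide_eq_true_eq, List.all_eq_true]
  tauto

/-- **ℕ-kit bridge**: the code-space check plus the family fact `labelW v = wdg d (labelCode v)` (`v < nv`) give the word-level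
check for the decoded row `decW d ts`. [folklore] -/
theorem rowOKg_of_codeRowOKN {labelW : ℕ → Word d} {labelCode : ℕ → ℕ} {nv : ℕ} {rw : ℚ × List (ℕ × ℚ)}
    {ts : List (ℕ × ℤ × ℕ)} {π : List ℕ} (hlab : ∀ v < nv, labelW v = wdg d (labelCode v))
    (h : codeRowOKN labelCode nv rw ts π = true) : rowOKg labelW nv rw (decW d ts) = true := by
  simp only [codeRowOKN, Bool.and_eq_true, List.all_eq_true, decide_eq_true_eq] at h
  obtain ⟨hshape, hm⟩ := h
  obtain ⟨h0, hnd, hrange, hlen, hπ, hπnd, hπlt⟩ := (shapeOK_iff nv rw ts.length π).1 hshape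
  have hperm : (rw.2.map fun p => (labelW p.1, p.2)).Perm ((decW d ts).map fun t => (t.1, t.2.1)) := by
    have hdec : (decW d ts).map (fun t => (t.1, t.2.1)) = ts.map (fun t => (wdg d t.1, (t.2.1 : ℚ) / t.2.2)) := by
      simp [decW, List.map_map, Function.comp_def]
    rw [hdec]
    refine perm_map_of_zip_witness rw.2 ts π _ _ (0, 0, 1) hlen hπ hπnd hπlt fun q hq => ?_
    obtain ⟨⟨hc, hden⟩, hcoef⟩ := hm q hq
    have hv : q.1.1 < nv := hrange q.1 (List.of_mem_zip hq).1
    have hden' : ((ts.getD q.2 (0, 0, 1)).2.2 : ℚ) ≠ 0 := by exact_mod_cast hden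
    refine Prod.ext ?_ ?_
    · simp only [hlab q.1.1 hv, hc]
    · simp only
      rw [eq_div_iff hden', hcoef]
  simp only [rowOKg, Bool.and_eq_true, decide_eq_true_eq, List.all_eq_true]
  refine ⟨⟨⟨⟨h0, hnd⟩, hrange⟩, fun t ht => ?_⟩, hperm⟩
  simp only [decW, List.mem_map] at ht
  obtain ⟨s, _, rfl⟩ := ht
  rfl

/-- **ℤ-kit bridge**: the code-space check plus the family fact give the word-level check for `decWZ d ts M`. [folklore] -/
theorem rowOKg_of_codeRowOKZ {labelW : ℕ → Word d} {labelCode : ℕ → ℕ} {nv : ℕ} {rw : ℚ × List (ℕ × ℚ)}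
    {ts : List (ℕ × ℤ)} {M : ℕ} {π : List ℕ} (hlab : ∀ v < nv, labelW v = wdg d (labelCode v))
    (h : codeRowOKZ labelCode nv rw ts M π = true) : rowOKg labelW nv rw (decWZ d ts M) = true := by
  simp only [codeRowOKZ, Bool.and_eq_true, List.all_eq_true, decide_eq_true_eq] at h
  obtain ⟨⟨hshape, hM⟩, hm⟩ := h
  obtain ⟨h0, hnd, hrange, hlen, hπ, hπnd, hπlt⟩ := (shapeOK_iff nv rw ts.length π).1 hshape
  have hM' : (M : ℚ) ≠ 0 := by exact_mod_cast hM
  have hperm : (rw.2.map fun p => (labelW p.1, p.2)).Perm ((decWZ d ts M).map fun t => (t.1, t.2.1)) := by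
    have hdec : (decWZ d ts M).map (fun t => (t.1, t.2.1)) = ts.map (fun t => (wdg d t.1, (t.2 : ℚ) / M)) := by
      simp [decWZ, List.map_map, Function.comp_def]
    rw [hdec]
    refine perm_map_of_zip_witness rw.2 ts π _ _ (0, 0) hlen hπ hπnd hπlt fun q hq => ?_
    obtain ⟨hc, hcoef⟩ := hm q hq
    have hv : q.1.1 < nv := hrange q.1 (List.of_mem_zip hq).1
    refine Prod.ext ?_ ?_
    · simp only [hlab q.1.1 hv, hc]
    · simp only
      rw [eq_div_iff hM', hcoef]
  simp only [rowOKg, Bool.and_eq_true, decide_eq_true_eq, List.all_eq_true]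
  refine ⟨⟨⟨⟨h0, hnd⟩, hrange⟩, fun t ht => ?_⟩, hperm⟩
  simp only [decWZ, List.mem_map] at ht
  obtain ⟨s, _, rfl⟩ := ht
  rfl

/-! ## Assembling chunked kernel checks -/

/-- Consecutive chunks `(lo, len)` tile `[0, N)`: starts at `0`, each chunk begins where the previous one ends, ends at `N`. -/
def chunksCover : ℕ → List (ℕ × ℕ) → ℕ → Bool
  | s, [], N => decide (s = N)
  | s, c :: cs, N => decide (c.1 = s) && chunksCover (s + c.2) cs N

/-- If the chunks tile `[start, N)` and `F` holds on every chunk (`(range' lo len).all F`), then `F e` for all `start ≤ e < N`. -/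
theorem forall_of_chunks_aux (F : ℕ → Bool) :
    ∀ (cs : List (ℕ × ℕ)) (s N : ℕ), chunksCover s cs N = true →
      (∀ c ∈ cs, (List.range' c.1 c.2).all F = true) → ∀ e, s ≤ e → e < N → F e = true
  | [], s, N, hcov, _, e, hs, he => by
    simp only [chunksCover, decide_eq_true_eq] at hcov
    omega
  | c :: cs, s, N, hcov, hall, e, hs, he => by
    simp only [chunksCover, Bool.and_eq_true, decide_eq_true_eq] at hcov
    obtain ⟨hc, hcov'⟩ := hcov
    by_cases hlt : e < s + c.2
    · have h := hall c (by simp)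
      rw [List.all_eq_true] at h
      have hm : e ∈ List.range' c.1 c.2 := by
        rw [List.mem_range'_1]
        omega
      simpa using h e hm
    · exact forall_of_chunks_aux F cs (s + c.2) N hcov' (fun c' hc' => hall c' (by simp [hc'])) e (by omega) he

/-- **Chunk assembly**: `chunksCover 0 cs N` and `F` checked on every chunk give `∀ e < N, F e = true`. [folklore] -/
theorem forall_lt_of_chunks (F : ℕ → Bool) (cs : List (ℕ × ℕ)) (N : ℕ) (hcov : chunksCover 0 cs N = true)
    (hall : ∀ c ∈ cs, (List.range' c.1 c.2).all F = true) : ∀ e < N, F e = true :=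
  fun e he => forall_of_chunks_aux F cs 0 N hcov hall e (Nat.zero_le _) he

/-- Pointwise form for a whole system: code checks for all rows `e < N` give the word checks for all rows. [folklore] -/
theorem rowsOKg_of_codeRowsOKN {labelW : ℕ → Word d} {labelCode : ℕ → ℕ} {nv N : ℕ}
    (hlab : ∀ v < nv, labelW v = wdg d (labelCode v)) (rows : ℕ → ℚ × List (ℕ × ℚ)) (code : ℕ → List (ℕ × ℤ × ℕ))
    (perm : ℕ → List ℕ) (h : ∀ e < N, codeRowOKN labelCode nv (rows e) (code e) (perm e) = true) :
    ∀ e < N, rowOKg labelW nv (rows e) (decW d (code e)) = true :=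
  fun e he => rowOKg_of_codeRowOKN hlab (h e he)

/-- Pointwise form for a whole system, ℤ-kit rows `(terms e, M e)`. [folklore] -/
theorem rowsOKg_of_codeRowsOKZ {labelW : ℕ → Word d} {labelCode : ℕ → ℕ} {nv N : ℕ}
    (hlab : ∀ v < nv, labelW v = wdg d (labelCode v)) (rows : ℕ → ℚ × List (ℕ × ℚ)) (code : ℕ → List (ℕ × ℤ))
    (M : ℕ → ℕ) (perm : ℕ → List ℕ) (h : ∀ e < N, codeRowOKZ labelCode nv (rows e) (code e) (M e) (perm e) = true) :
    ∀ e < N, rowOKg labelW nv (rows e) (decWZ d (code e) (M e)) = true :=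
  fun e he => rowOKg_of_codeRowOKZ hlab (h e he)

end Summit.QuantumFields.GaugeBoot.BindBridge
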